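import Mathlib
import HarnessLib
import Summits.QuantumFields.YangMills.Theses.PencilRigidity

/-!
# `KernelTransfer` — approximate identities and changes of variables (support for stmt-QuantumFields-11688)

Support file for the item `PencilRigidity.KernelTransfer` (stmt-QuantumFields-11688): the
model-blind analysis glue turning the distributional two-point data `𝔖₂(F) = ∫ K(x₀ - x₁) F`
on `⁰𝒮` into pointwise statements about the kernel `K`.  This file collects, without auxiliary
definitions (all bump functions are built inside the proofs),

* `abs_integral_mul_sub_le` — the concentration estimate: for a non-negative weight `ψ` of
  total mass `1` supported in a set on which `|W - w₀| ≤ δ`, `|∫ W ψ - w₀| ≤ δ`;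
* `exists_onePoint_bump` — normalised smooth bumps `β ≥ 0`, `∫ β = 1`, supported in a small
  ball around a point of positive time, lifted to time-ordered one-point test functions
  `φ ∈ 𝒮((ℝ⁴)¹)`, `φ(w) = β(w 0)`;
* `osPair_apply`, `isOffDiagonal_osPair`, `integral_osPair` — the E2 witness
  `θφ_a* ⊗ φ_b` of two such bumps is the real non-negative weight
  `y ↦ β_a(θ y₀) β_b(y₁)`, lies in `⁰𝒮`, and has total mass `1`;
* `integral_comp_isometry_two`, `integrable_comp_isometry_two`, `isOffDiagonal_linActMulti_two`,
  `rep_pullback` — change of variables under the diagonal action of a linear isometry `R`, the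
  stability of `⁰𝒮((ℝ⁴)²)` under it (adapted from the refuter file
  `Theorems/CurvatureKernelBound/Negative/L1Extension.lean`), and the representation of the
  pulled-back family `𝔖 ∘ (· ∘ R⁻¹)` by the kernel `K ∘ R`;
* `osPair_twoPoint_eq`, `osPair_twoPoint` — `𝔖₂(θφ_a* ⊗ φ_b)` is the real number
  `∫ K(y₀ - y₁) β_a(θy₀) β_b(y₁)`, within `δ` of `K(θa - b)` once the bumps are small.
[folklore]
-/

noncomputable section

-- Mathlib's `SimplexCategory` instance `Fintype (Fin (x.len + 1))` matches `Fintype (Fin 4)` and makes concrete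
-- `Fin 4` instance paths diverge between elaborations (tree-known workaround).
attribute [-instance] SimplexCategory.instFintypeToTypeOrderHomFinHAddNatLenOfNat

open scoped BigOperators Topology SchwartzMap ComplexConjugate
open MeasureTheory Filter Set
open Literature.MathematicalPhysics.QuantumLattice Literature.MathematicalPhysics.AQFT

namespace Summit.QuantumFields.YangMills.Theorems.KernelTransfer

local notation "E4" => EuclideanSpace ℝ (Fin 4)

/-! ## The concentration estimate -/

/-- **Concentration estimate.** If `ψ ≥ 0` has total mass `1` and is supported in a set `S` on
which `|W - w₀| ≤ δ`, then `|∫ W ψ - w₀| ≤ δ` (for `W ψ` integrable). [folklore] -/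
theorem abs_integral_mul_sub_le {α : Type*} [MeasurableSpace α] {μ : Measure α}
    {ψ W : α → ℝ} {w₀ δ : ℝ} {S : Set α}
    (hψ0 : ∀ v, 0 ≤ ψ v) (hψ1 : ∫ v, ψ v ∂μ = 1) (hsupp : ∀ v, ψ v ≠ 0 → v ∈ S)
    (hW : ∀ v ∈ S, |W v - w₀| ≤ δ) (hint : Integrable (fun v => W v * ψ v) μ) :
    |(∫ v, W v * ψ v ∂μ) - w₀| ≤ δ := by
  have hψint : Integrable ψ μ := by
    by_contra h
    rw [integral_undef h] at hψ1
    exact zero_ne_one hψ1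
  have hsub : (∫ v, W v * ψ v ∂μ) - w₀ = ∫ v, (W v - w₀) * ψ v ∂μ := by
    have h1 : ∫ v, (W v - w₀) * ψ v ∂μ = (∫ v, W v * ψ v ∂μ) - ∫ v, w₀ * ψ v ∂μ := by
      rw [← integral_sub hint (hψint.const_mul w₀)]
      refine integral_congr_ae (Eventually.of_forall fun v => ?_)
      ring
    rw [h1, integral_const_mul, hψ1, mul_one]
  rw [hsub]
  have hbound : ∀ v, ‖(W v - w₀) * ψ v‖ ≤ δ * ψ v := by
    intro v
    by_cases hv : ψ v = 0
    · simp [hv]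
    · rw [norm_mul, Real.norm_eq_abs, Real.norm_eq_abs, abs_of_nonneg (hψ0 v)]
      exact mul_le_mul_of_nonneg_right (hW v (hsupp v hv)) (hψ0 v)
  have h := norm_integral_le_of_norm_le (hψint.const_mul δ) (Eventually.of_forall hbound)
  rw [integral_const_mul, hψ1, mul_one, Real.norm_eq_abs] at h
  exact h

/-! ## Normalised bumps as one-point test functions -/

/-- A coordinate of a point of `ℝ⁴` is bounded by its norm. [folklore] -/
theorem abs_apply_le_norm (x : E4) (i : Fin 4) : |x i| ≤ ‖x‖ := by
  have h := EuclideanSpace.norm_eq x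
  have hi : ‖x i‖ ^ 2 ≤ ∑ j, ‖x j‖ ^ 2 :=
    Finset.single_le_sum (f := fun j => ‖x j‖ ^ 2) (fun j _ => sq_nonneg _) (Finset.mem_univ i)
  have h2 : |x i| = Real.sqrt (‖x i‖ ^ 2) := by
    rw [Real.norm_eq_abs, Real.sqrt_sq (abs_nonneg _)]
  rw [h, h2]
  exact Real.sqrt_le_sqrt hi

/-- **Normalised one-point bumps.** Around a point `a` of positive time and for a radius
`0 < r < a⁰` there is a smooth weight `β ≥ 0` of total mass `1` supported in the open ball
`B(a, r)`, and a time-ordered one-point test function `φ ∈ 𝒮((ℝ⁴)¹)` with `φ(w) = β(w₀)`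
(Mathlib's `ContDiffBump.normed`, lifted by `SchwartzMap.tensorFin 1`). [folklore] -/
theorem exists_onePoint_bump (a : E4) {r : ℝ} (hr : 0 < r) (hra : r < a 0) :
    ∃ (β : E4 → ℝ) (φ : 𝓢((Fin 1 → E4), ℂ)),
      Continuous β ∧ (∀ z, 0 ≤ β z) ∧ (∫ z, β z = 1) ∧ (∀ z, β z ≠ 0 → dist z a < r) ∧
      (∀ w, φ w = ((β (w 0) : ℝ) : ℂ)) ∧ IsTimeOrdered φ := by
  let b : ContDiffBump a := ⟨r / 2, r, half_pos hr, half_lt_self hr⟩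
  let β : E4 → ℝ := b.normed volume
  have hβc : Continuous β := b.continuous_normed
  have hβ0 : ∀ z, 0 ≤ β z := fun z => b.nonneg_normed z
  have hβ1 : ∫ z, β z = 1 := b.integral_normed
  have hβsupp : ∀ z, β z ≠ 0 → dist z a < r := by
    intro z hz
    have : z ∈ Function.support β := hz
    rw [b.support_normed_eq] at this
    exact this
  -- the complex one-point Schwartz function
  have hcs : HasCompactSupport (fun z : E4 => ((β z : ℝ) : ℂ)) :=
    b.hasCompactSupport_normed.comp_left Complex.ofReal_zero
  have hcd : ContDiff ℝ (⊤ : ℕ∞) (fun z : E4 => ((β z : ℝ) : ℂ)) :=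
    (Complex.ofRealCLM.contDiff.comp b.contDiff_normed)
  let φ₁ : 𝓢(E4, ℂ) := hcs.toSchwartzMap hcd
  have hφ₁ : ∀ z, φ₁ z = ((β z : ℝ) : ℂ) := fun _ => rfl
  let φ : 𝓢((Fin 1 → E4), ℂ) := SchwartzMap.tensorFin 1 ![φ₁]
  have hφ : ∀ w, φ w = ((β (w 0) : ℝ) : ℂ) := by
    intro w
    simp [φ, hφ₁]
  refine ⟨β, φ, hβc, hβ0, hβ1, hβsupp, hφ, ?_⟩
  -- time-orderedness: the support sits in the closed ball of radius `r < a⁰` around `a`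
  have hclosed : IsClosed {w : Fin 1 → E4 | w 0 ∈ Metric.closedBall a r} :=
    Metric.isClosed_closedBall.preimage (continuous_apply 0)
  have hsub : Function.support (φ : (Fin 1 → E4) → ℂ) ⊆ {w : Fin 1 → E4 | w 0 ∈ Metric.closedBall a r} := by
    intro w hw
    rw [Function.mem_support, hφ] at hw
    have hw' : β (w 0) ≠ 0 := by exact_mod_cast hw
    exact Metric.mem_closedBall.2 (hβsupp _ hw').le
  intro w hw
  have hw' : w 0 ∈ Metric.closedBall a r := (closure_minimal hsub hclosed) hw
  rw [Metric.mem_closedBall, dist_eq_norm] at hw'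
  have h0 : 0 < w 0 0 := by
    have h1 : |(w 0 - a) 0| ≤ ‖w 0 - a‖ := abs_apply_le_norm _ 0
    rw [PiLp.sub_apply, abs_le] at h1
    linarith [h1.1]
  refine ⟨fun i => ?_, fun i j hij => ?_⟩
  · rw [Subsingleton.elim i 0]; exact h0
  · exact absurd hij (by rw [Subsingleton.elim i j]; exact lt_irrefl _)

/-! ## The E2 witness `θφ_a* ⊗ φ_b` of two one-point bumps -/

/-- Pointwise formula: for one-point test functions `φ_a(w) = β_a(w₀)`, `φ_b(w) = β_b(w₀)` with
real `β_a, β_b`, the tensor `θφ_a* ⊗ φ_b` is the real weight `y ↦ β_a(θ y₀) β_b(y₁)`.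
[folklore] -/
theorem osPair_apply {βa βb : E4 → ℝ} {φa φb : 𝓢((Fin 1 → E4), ℂ)}
    (hφa : ∀ w, φa w = ((βa (w 0) : ℝ) : ℂ)) (hφb : ∀ w, φb w = ((βb (w 0) : ℝ) : ℂ))
    (y : Fin (1 + 1) → E4) :
    SchwartzMap.appendTensor (osAdjoint φa) φb y =
      ((βa (timeReflection 4 (y 0)) * βb (y 1) : ℝ) : ℂ) := by
  rw [SchwartzMap.appendTensor_apply, osAdjoint_apply, hφa, hφb, Complex.conj_ofReal]
  push_cast
  rfl

/-- The weight `y ↦ β_a(θ y₀) β_b(y₁)` of two bumps at points `a, b` of positive time, of radius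
`r < a⁰, b⁰`, is supported off the diagonal: any test function with this pointwise formula lies in
`⁰𝒮((ℝ⁴)²)`. [folklore] -/
theorem isOffDiagonal_osPair {βa βb : E4 → ℝ} {a b : E4} {r : ℝ}
    (hra : r < a 0) (hrb : r < b 0)
    (hβa : ∀ z, βa z ≠ 0 → dist z a < r) (hβb : ∀ z, βb z ≠ 0 → dist z b < r)
    {H : 𝓢((Fin 2 → E4), ℂ)}
    (hH : ∀ y, H y = ((βa (timeReflection 4 (y 0)) * βb (y 1) : ℝ) : ℂ)) :
    IsOffDiagonal H := by
  refine IsOffDiagonal.of_tsupport_subset ?_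
  let T : Set (Fin 2 → E4) :=
    {y | timeReflection 4 (y 0) ∈ Metric.closedBall a r ∧ y 1 ∈ Metric.closedBall b r}
  have hT : IsClosed T := by
    have h0 : Continuous fun y : Fin 2 → E4 => timeReflection 4 (y 0) :=
      (timeReflection 4).continuous.comp (continuous_apply 0)
    have h1 : Continuous fun y : Fin 2 → E4 => y 1 := continuous_apply 1
    exact (Metric.isClosed_closedBall.preimage h0).inter (Metric.isClosed_closedBall.preimage h1)
  have hsub : Function.support (H : (Fin 2 → E4) → ℂ) ⊆ T := by
    intro y hy
    rw [Function.mem_support, hH] at hy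
    have hy' : βa (timeReflection 4 (y 0)) * βb (y 1) ≠ 0 := by exact_mod_cast hy
    obtain ⟨h0, h1⟩ := mul_ne_zero_iff.1 hy'
    exact ⟨Metric.mem_closedBall.2 (hβa _ h0).le, Metric.mem_closedBall.2 (hβb _ h1).le⟩
  intro y hy hloc
  obtain ⟨h0, h1⟩ := (closure_minimal hsub hT) hy
  rw [Metric.mem_closedBall, dist_eq_norm] at h0 h1
  have e0 : |(timeReflection 4 (y 0) - a) 0| ≤ ‖timeReflection 4 (y 0) - a‖ := abs_apply_le_norm _ 0
  have e1 : |(y 1 - b) 0| ≤ ‖y 1 - b‖ := abs_apply_le_norm _ 0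
  rw [PiLp.sub_apply, timeReflection_apply, if_pos rfl, abs_le] at e0
  rw [PiLp.sub_apply, abs_le] at e1
  have hlt : y 0 0 < y 1 0 := by linarith [e0.2, e1.1]
  obtain ⟨i, j, hij, hyij⟩ := hloc
  have h01 : y 0 = y 1 := by
    fin_cases i <;> fin_cases j
    · exact absurd rfl hij
    · exact hyij
    · exact hyij.symm
    · exact absurd rfl hij
  rw [h01] at hlt
  exact lt_irrefl _ hlt

/-- The weight `y ↦ β_a(θ y₀) β_b(y₁)` has total mass `(∫ β_a)(∫ β_b)` = `1` (Fubini and the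
invariance of Lebesgue measure under the time reflection). [folklore] -/
theorem integral_osPair {βa βb : E4 → ℝ} (ha : ∫ z, βa z = 1) (hb : ∫ z, βb z = 1) :
    ∫ y : Fin 2 → E4, βa (timeReflection 4 (y 0)) * βb (y 1) = 1 := by
  have hθ : ∫ z, βa (timeReflection 4 z) = 1 := by
    rw [← ha]
    exact (timeReflection 4).measurePreserving.integral_comp
      (timeReflection 4).toHomeomorph.measurableEmbedding βa
  have hfun : (fun y : Fin 2 → E4 => βa (timeReflection 4 (y 0)) * βb (y 1)) =
      fun y => ∏ i : Fin 2, (![fun z => βa (timeReflection 4 z), βb] i) (y i) := by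
    funext y
    simp [Fin.prod_univ_two]
  rw [hfun, integral_fintype_prod_volume_eq_prod]
  simp [Fin.prod_univ_two, hθ, hb]

/-! ## Changes of variables on `(ℝ⁴)²` -/

/-- Change of variables under the diagonal action of a linear isometry (adapted from
`Theorems/CurvatureKernelBound/Negative/L1Extension.lean`). [folklore] -/
theorem integral_comp_isometry_two (R : E4 ≃ₗᵢ[ℝ] E4) (G : (Fin 2 → E4) → ℂ) :
    ∫ x : Fin 2 → E4, G (fun i => R (x i)) = ∫ x, G x := by
  have h : MeasurePreserving (fun (x : Fin 2 → E4) (i : Fin 2) => R (x i)) :=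
    volume_preserving_pi fun _ => R.measurePreserving
  let e : (Fin 2 → E4) ≃ᵐ (Fin 2 → E4) :=
    MeasurableEquiv.piCongrRight fun _ => R.toHomeomorph.toMeasurableEquiv
  have he : (e : (Fin 2 → E4) → (Fin 2 → E4)) = fun x i => R (x i) := rfl
  have h' : MeasurePreserving e := by rw [he]; exact h
  exact h'.integral_comp' G

/-- Integrability is preserved under the diagonal action of a linear isometry. [folklore] -/
theorem integrable_comp_isometry_two (R : E4 ≃ₗᵢ[ℝ] E4) {G : (Fin 2 → E4) → ℂ}
    (hG : Integrable G) : Integrable (fun x : Fin 2 → E4 => G (fun i => R (x i))) := by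
  have h : MeasurePreserving (fun (x : Fin 2 → E4) (i : Fin 2) => R (x i)) :=
    volume_preserving_pi fun _ => R.measurePreserving
  let e : (Fin 2 → E4) ≃ᵐ (Fin 2 → E4) :=
    MeasurableEquiv.piCongrRight fun _ => R.toHomeomorph.toMeasurableEquiv
  have he : (e : (Fin 2 → E4) → (Fin 2 → E4)) = fun x i => R (x i) := rfl
  have h' : MeasurePreserving e := by rw [he]; exact h
  have := (h'.integrable_comp_emb e.measurableEmbedding).2 hG
  rw [he] at this
  exact this

/-- `⁰𝒮((ℝ⁴)²)` is stable under the diagonal action of a linear isometry (adapted from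
`Theorems/CurvatureKernelBound/Negative/L1Extension.lean`). [folklore] -/
theorem isOffDiagonal_linActMulti_two {F : 𝓢((Fin 2 → E4), ℂ)} (hF : IsOffDiagonal F)
    (R : E4 ≃ₗᵢ[ℝ] E4) : IsOffDiagonal (linActMulti R F) := by
  intro x hx k
  let g : (Fin 2 → E4) ≃L[ℝ] (Fin 2 → E4) :=
    ContinuousLinearEquiv.piCongrRight fun _ : Fin 2 => R.symm.toContinuousLinearEquiv
  have hfun : ((linActMulti R F : 𝓢((Fin 2 → E4), ℂ)) : (Fin 2 → E4) → ℂ) =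
      (F : (Fin 2 → E4) → ℂ) ∘ g := funext fun _ => rfl
  have hg : g x ∈ coincidenceLocus 2 E4 := by
    obtain ⟨i, j, hij, hxij⟩ := hx
    exact ⟨i, j, hij, by simp [g, hxij]⟩
  have key := (g : (Fin 2 → E4) →L[ℝ] (Fin 2 → E4)).iteratedFDeriv_comp_right (F.smooth k) x
    (i := k) le_rfl
  simp only [ContinuousLinearEquiv.coe_coe] at key
  rw [hfun, key, hF _ hg k]
  ext m
  simp

/-- **Pull-back of the two-point representation.** If `𝔖₂(F) = ∫ K(x₀ - x₁) F` on `⁰𝒮`, then the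
family pulled back by a linear isometry `R`, `F ↦ 𝔖₂(F ∘ R⁻¹)`, is represented on `⁰𝒮` by the
kernel `K ∘ R` (isometry-invariance of Lebesgue measure). [folklore] -/
theorem rep_pullback {S : SchwingerFamily E4} {K : E4 → ℝ}
    (hrep : ∀ F : 𝓢((Fin 2 → E4), ℂ), IsOffDiagonal F →
      Integrable (fun x : Fin 2 → E4 => (K (x 0 - x 1) : ℂ) * F x) ∧
        S 2 F = ∫ x : Fin 2 → E4, (K (x 0 - x 1) : ℂ) * F x)
    (R : E4 ≃ₗᵢ[ℝ] E4) (F : 𝓢((Fin 2 → E4), ℂ)) (hF : IsOffDiagonal F) :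
    Integrable (fun x : Fin 2 → E4 => (K (R (x 0 - x 1)) : ℂ) * F x) ∧
      S 2 (linActMulti R F) = ∫ x : Fin 2 → E4, (K (R (x 0 - x 1)) : ℂ) * F x := by
  obtain ⟨hint, hS⟩ := hrep (linActMulti R F) (isOffDiagonal_linActMulti_two hF R)
  have hfun : (fun x : Fin 2 → E4 => (K (R (x 0 - x 1)) : ℂ) * F x) =
      fun x => (fun y : Fin 2 → E4 => (K (y 0 - y 1) : ℂ) * linActMulti R F y) (fun i => R (x i)) := by
    funext x
    simp only [linActMulti_apply, LinearIsometryEquiv.symm_apply_apply, map_sub]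
  refine ⟨?_, ?_⟩
  · rw [hfun]
    exact integrable_comp_isometry_two R hint
  · rw [hS, hfun]
    exact (integral_comp_isometry_two R (fun y : Fin 2 → E4 => (K (y 0 - y 1) : ℂ) * linActMulti R F y)).symm

/-! ## The two-point function on a concentrated pair of bumps -/

/-- **Two-point function of an E2 pair witness.** If `𝔖₂ = ∫ K(x₀ - x₁)·` on `⁰𝒮` and `H` is
the weight `β_a(θ y₀) β_b(y₁)` of two bumps of radius `r` at points `a, b` of time `> r`, then
`𝔖₂(H)` is the real number `∫ K(y₀ - y₁) β_a(θ y₀) β_b(y₁) dy` (with an integrable integrand).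
[folklore] -/
theorem osPair_twoPoint_eq {S : SchwingerFamily E4} {K : E4 → ℝ}
    (hrep : ∀ F : 𝓢((Fin 2 → E4), ℂ), IsOffDiagonal F →
      Integrable (fun x : Fin 2 → E4 => (K (x 0 - x 1) : ℂ) * F x) ∧
        S 2 F = ∫ x : Fin 2 → E4, (K (x 0 - x 1) : ℂ) * F x)
    {βa βb : E4 → ℝ} {a b : E4} {r : ℝ} (hra : r < a 0) (hrb : r < b 0)
    (hβa : ∀ z, βa z ≠ 0 → dist z a < r) (hβb : ∀ z, βb z ≠ 0 → dist z b < r)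
    {H : 𝓢((Fin 2 → E4), ℂ)}
    (hH : ∀ y, H y = ((βa (timeReflection 4 (y 0)) * βb (y 1) : ℝ) : ℂ)) :
    S 2 H = ((∫ y : Fin 2 → E4, K (y 0 - y 1) * (βa (timeReflection 4 (y 0)) * βb (y 1)) : ℝ) : ℂ) ∧
      Integrable (fun y : Fin 2 → E4 => K (y 0 - y 1) * (βa (timeReflection 4 (y 0)) * βb (y 1))) := by
  obtain ⟨hint, hS⟩ := hrep H (isOffDiagonal_osPair hra hrb hβa hβb hH)
  set fR : (Fin 2 → E4) → ℝ := fun y => K (y 0 - y 1) * (βa (timeReflection 4 (y 0)) * βb (y 1))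
    with hfR
  have hfun : (fun y : Fin 2 → E4 => (K (y 0 - y 1) : ℂ) * H y) = fun y => ((fR y : ℝ) : ℂ) := by
    funext y; rw [hH]; push_cast; simp [fR]
  rw [hfun] at hint hS
  rw [integral_complex_ofReal] at hS
  have hintR : Integrable fR := by
    have := hint.re
    simpa using this
  exact ⟨hS, hintR⟩

/-- **Two-point function of a concentrated E2 witness.** If `𝔖₂ = ∫ K(x₀ - x₁)·` on `⁰𝒮` and `H`
is the weight `β_a(θ y₀) β_b(y₁)` of two normalised bumps of radius `r` at points `a, b` of time
`> r`, then `𝔖₂(H)` is real and within `δ` of `K(θa - b)` as soon as `K` varies by at most `δ`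
on the ball of radius `2r` around `θa - b`. [folklore] -/
theorem osPair_twoPoint {S : SchwingerFamily E4} {K : E4 → ℝ}
    (hrep : ∀ F : 𝓢((Fin 2 → E4), ℂ), IsOffDiagonal F →
      Integrable (fun x : Fin 2 → E4 => (K (x 0 - x 1) : ℂ) * F x) ∧
        S 2 F = ∫ x : Fin 2 → E4, (K (x 0 - x 1) : ℂ) * F x)
    {βa βb : E4 → ℝ} {a b : E4} {r δ : ℝ} (hra : r < a 0) (hrb : r < b 0)
    (hβa0 : ∀ z, 0 ≤ βa z) (hβb0 : ∀ z, 0 ≤ βb z) (hβa1 : ∫ z, βa z = 1) (hβb1 : ∫ z, βb z = 1)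
    (hβa : ∀ z, βa z ≠ 0 → dist z a < r) (hβb : ∀ z, βb z ≠ 0 → dist z b < r)
    (hK : ∀ z, dist z (timeReflection 4 a - b) < r + r → |K z - K (timeReflection 4 a - b)| ≤ δ)
    {H : 𝓢((Fin 2 → E4), ℂ)}
    (hH : ∀ y, H y = ((βa (timeReflection 4 (y 0)) * βb (y 1) : ℝ) : ℂ)) :
    |(S 2 H).re - K (timeReflection 4 a - b)| ≤ δ ∧ (S 2 H).im = 0 := by
  obtain ⟨hS, hintR⟩ := osPair_twoPoint_eq hrep hra hrb hβa hβb hH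
  rw [hS, Complex.ofReal_re, Complex.ofReal_im]
  refine ⟨?_, rfl⟩
  -- concentration
  refine abs_integral_mul_sub_le (S := {y : Fin 2 → E4 | dist (y 0 - y 1) (timeReflection 4 a - b) < r + r})
    (fun y => mul_nonneg (hβa0 _) (hβb0 _)) (integral_osPair hβa1 hβb1) (fun y hy => ?_)
    (fun y hy => hK _ hy) hintR
  obtain ⟨h0, h1⟩ := mul_ne_zero_iff.1 hy
  have d0 := hβa _ h0
  have d1 := hβb _ h1
  rw [Set.mem_setOf_eq]
  rw [dist_eq_norm] at d0 d1 ⊢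
  have e0 : ‖y 0 - timeReflection 4 a‖ = ‖timeReflection 4 (y 0) - a‖ := by
    rw [← (timeReflection 4).norm_map (y 0 - timeReflection 4 a), map_sub,
      timeReflection_timeReflection]
  calc ‖y 0 - y 1 - (timeReflection 4 a - b)‖ = ‖(y 0 - timeReflection 4 a) - (y 1 - b)‖ := by
        congr 1; abel
    _ ≤ ‖y 0 - timeReflection 4 a‖ + ‖y 1 - b‖ := norm_sub_le _ _
    _ < r + r := by rw [e0]; exact add_lt_add d0 d1

end Summit.QuantumFields.YangMills.Theorems.KernelTransfer

end
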